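import Summits.BirchSwinnertonDyer.Rank1Residual.Supersingular.BlindPointFlatTwo
import Literature.NumberTheory.EllipticCurves.QuadraticTwist
import Literature.NumberTheory.EllipticCurves.BSDRootNumberSmallConductorProofs
import Literature.NumberTheory.EllipticCurves.Rank1Residual.Predicates
import Literature.NumberTheory.EllipticCurves.GlobalMinimalModel
import Literature.NumberTheory.EllipticCurves.FormalGroup
import Literature.NumberTheory.EllipticCurves.PadicFormalLogOrder
import Literature.NumberTheory.EllipticCurves.BSDInvariants
import Literature.NumberTheory.EllipticCurves.MazurTateElementOdd
import Literature.NumberTheory.EllipticCurves.Heights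
import Literature.NumberTheory.EllipticCurves.AnalyticRank
import HarnessLib

/-!
# -an g40 · §44 — ISOGENY AUDIT of the ψ₂-dictionary, its CANONICAL-PERIOD repair, the ODD branch `χ₋₈`
# (κ₀⁻ = −κ₀⁺) and the class-invariant «blind 2-adic Gross–Zagier ratio» (44C±, constant ±4)

Crux `ByReductionTypeAtTwo.RankOneAtTwoBigImageOddLocal` (stmt-BirchSwinnertonDyer-23715); cell bsd-f1-sign2, lens
analytic / Waldspurger–Gross–Zagier.  Continues AN57 (`BlindGZAN57.FlatBlindGrossZagierAtChi8` = P-an-43A).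

§44 FINDING (A), negative knowledge: 43A quantifies over EVERY globally minimal `W` with `IsNewformOf W f`, i.e. over
the whole isogeny class of `f`; but its two sides scale differently under an isogeny `φ : W → W′` of degree `d`
with `φ*ω′ = c·ω`: `m₂₁(W′) = (c²/d)·m₂₁(W)` (functoriality of the de Rham pairing; engine 49, K = 22: 11a3/11a1 = 5,
11a2/11a1 = 1/5, 19a2 = 1/3, 19a3 = 3, 651e2 = 1/3, 651e3 = 1/9 mod 2¹¹, = c²/d exactly) while
`Tam·Ш·log²/ι²` on the twist side scales by `(c²/d)·Ω(W₂)/Ω(W₂′)` (BSD + invariance of `L′`), so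
`R(W′)/R(W) = Ω(W₂′)/Ω(W₂)`: MEASURED 6/6 to 11 bits (ρ = 1/5, 5, 1/3, 3, 1/3, 1/9 for the χ₈-twists of
11a2, 11a3, 19a2, 19a3, 651e2, 651e3).  Hence 43A AS TYPED IS FALSE at every class member whose χ₈-twist does not
have the canonical period (class: misstated; the law and κ₀ = −4/log₂γ are correct for the member with
`Ω(W₂)·√8 = 2·Ω⁺_f`, which the X₀(N)-optimal curve satisfies on every row: Pal 2012 Thm 3.2 with ũ = 2).
This file states the REPAIRED law 44A⁺ (`FlatBlindGrossZagierAtChi8Q`: 43A with the rational period ratio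
`q = Ω(W₂)√8/(2Ω⁺_f)` of the twist as a new binder, `8 ↦ 8q` — REF1 R388a's repair C′ read on the twist; a new name, 43A is
not re-worded in place), its ODD-branch twin 44A⁻ at `χ₋₈` (twist by −2, Sprung's
odd pair, constant −8: κ₀⁻ = +4/log₂γ = −κ₀⁺, pre-registered set {1441, 607} mod 2¹¹, observed 607 = −1441), and
the class-invariant, Ш/Tam/torsion/index-free form 44C± (`BlindPAdicGrossZagierRatioPlus/Minus`): the 2-adic
product `L♭(ψ₂)·⟨ω,φω⟩·log₂γ` times the ALGEBRAIC PART `q = Ω^±_f·ĥ(P)/(√8·L′(E^{(±2)},1)) ∈ ℚ` of the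
archimedean Gross–Zagier ratio equals `±4·log_ω(P)²` — a p-adic Gross–Zagier formula at p = 2 at the blind
character, in which the p-adic height has degenerated to `log²/⟨ω,φω⟩`.  In the s-variable
(`d/ds = log₂γ·(1+T)·d/dT`, `1+T = −1` at ψ₂; REF2 v70-add3 rider (a)) the constants are the pure 2-powers ∓4.

ENGINES (kit tag `bsd-frontier-data`, -an g40 job50): (50) = engine 48 of AN57 generalised to both signs
(`msfromell(E,0)`: x⁺, x⁻; OMS `mspadicinit(M,2,32,1)`/`mstooms` per sign; χ₈ resp. χ₋₈ cosets mod 8/16 integrated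
directly; Birch calibration of the tree units `[r]^± = −x^±_PARI(r)/c_∞` on d ∈ {−3,−4,−7,−8,−11,5,8,12,13} for every
curve; Pal ratios `Ω(E_d)√|d|/Ω^{sgn d}_f`; all members of the isogeny class and of the twist classes, `ellpadiclog`
of the generators to 96 bits by two methods); (49) Katz–ASD Frobenius column, K = 22, on every class member.
Evidence: `Cruxes/RankOneAtTwoBigImageOddLocal/CensusAN46.md` (sha16 inside).

PARTITION 4/4/3/1 unchanged; beyond-print theorem: no (conjectures + data; 43A's failure off the canonical member is a
COMPUTATION, recorded in CensusAN46 §A); BSD is not proved here.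
-/

noncomputable section

open scoped Classical MatrixGroups ModularForm

open PowerSeries WeierstrassCurve CongruenceSubgroup Literature.NumberTheory.EllipticCurves
  Literature.NumberTheory.EllipticCurves.ModularForms Literature.NumberTheory.EllipticCurves.Sprung2017
  Literature.NumberTheory.EllipticCurves.Rank1Residual
  Summit.BirchSwinnertonDyer.Rank1Residual.Supersingular
  Summit.BirchSwinnertonDyer.Rank1Residual.Supersingular.BlindLever


namespace Summit.BirchSwinnertonDyer.Cruxes.RankOneAtTwoBigImageOddLocal.BlindGZAN58

/-! Mirror of the Katz-column vocabulary of `BlindGZAN57` (same text; crux workfiles are not built on the farm, so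
they cannot be imported — -ty R380c asks for one home; until then each §-file mirrors). -/

/-- `f₂ = ∫η` regularised: `Σ_{N ≥ 1} (d(N)/N) z^N`, `d(N) = coeff (N+1) (z²x(z)·ω(z)/dz)`.
[Katz 1981 §5] [folklore] -/
def formalEtaIntegral {A : Type*} [CommRing A] [Algebra ℚ A] (V : WeierstrassCurve A) : A⟦X⟧ :=
  PowerSeries.mk fun N =>
    if N = 0 then 0 else algebraMap ℚ A (1 / (N : ℚ)) * coeff (N + 1) (V.formalXMulSq * V.formalOmega)

/-- The Frobenius lift `f(z) ↦ f(z²)`. [Katz 1981 §3] [folklore] -/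
def frobTwo {A : Type*} [CommRing A] (g : A⟦X⟧) : A⟦X⟧ :=
  PowerSeries.mk fun n => if 2 ∣ n then coeff (n / 2) g else 0

/-- `2`-adic integrality of a power series over `ℚ_[2]`. [folklore] -/
def IsTwoAdicIntegral (g : ℚ_[2]⟦X⟧) : Prop := ∀ n : ℕ, ‖coeff n g‖ ≤ 1

/-- Katz's first Frobenius column `(m₁₁, m₂₁)` of `φ` on `D(Ê)` in the basis `(ω, η = x·ω)` of the model `V`:
`F(log_V) − m₁₁·log_V − m₂₁·f₂` is `2`-integral.  `m₂₁ = ⟨ω, φω⟩`-coordinate is a MODEL invariant but NOT an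
isogeny invariant: under `φ : W → W′`, `deg φ = d`, `φ*ω′ = c·ω`, one has `m₂₁(W′)·d = c²·m₂₁(W)` (§44 (A)).
[Katz 1981 §5 / ASD congruences] [folklore] -/
def IsKatzFrobeniusColumn (V : WeierstrassCurve ℚ_[2]) (m₁₁ m₂₁ : ℤ_[2]) : Prop :=
  IsTwoAdicIntegral
    (frobTwo V.formalLog - C (m₁₁ : ℚ_[2]) * V.formalLog - C (m₂₁ : ℚ_[2]) * formalEtaIntegral V)

/-- `log₂ γ = log₂ 5 ∈ ℚ_[2]` (γ = `cyclotomicGenerator 2 = 5`), `v₂ = 2`; `−4/log₂γ ≡ 1441`, `+4/log₂γ ≡ 607 (mod 2¹¹)`.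
[folklore] -/
def logCycGenTwo : ℚ_[2] := ∑' k : ℕ, -((-4 : ℚ_[2]) ^ (k + 1)) / ((k : ℚ_[2]) + 1)

/-- **P-an-44A⁺ `FlatBlindGrossZagierAtChi8Q` (conjecture; -an g40 §44 — the REPAIRED ψ₂-dictionary, q-form; = REF1 R388a
repair C′ with the period ratio read on the TWIST).**  `BlindGZAN57.FlatBlindGrossZagierAtChi8` (43A) with ONE new
binder, the rational PERIOD RATIO of the twist model, `q = Ω(W₂)·√8 / (2·Ω⁺_f)` (`(q : ℝ) * (2 * plusPeriod f) =
W₂.realPeriodRat * √8`), inserted linearly on the right: `… = 8·q·Tam·Ш·log²`.  `q = 1` is the CANONICAL member — the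
X₀(N)-optimal curve on every census row (Pal 2012 Thm 3.2 with ũ = 2; engine-50 Pal column = 2.000, CensusAN46 §D) — and
for a class member `W′` reached by an isogeny of degree `d` with `φ*ω′ = c·ω` one has `q(W′) = q(W)·Ω(W′₂)/Ω(W₂)`, which is
exactly the measured defect of 43A: ρ = R(W′)/κ₀ ≡ Ω(W′₂)/Ω(W₂^{opt}) = 1/5, 5, 1/3, 3, 1/3, 1/9 (11a2, 11a3, 19a2, 19a3,
651e2, 651e3; 6/6 to 11 bits; REF1 K388 predicted 1517, 1061, 1163, 227 mod 2¹¹ for 11a2, 11a3, 19a(Ω/3), 19a(3Ω): all four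
observed).  For d = +8, `Ω(W′₂)/Ω(W₂) = Ω(W′)/Ω(W)` (REF1's reading `q·Ω⁺_f = Ω(W)`), but NOT for d = −8 (there the
imaginary period enters: 44A⁻), which is why q is read on the twist.  Statement: on the odd χ₈-locus `w(E)·χ₈(N) = −1`, for
`E₂ = E^{(2)}` of analytic rank 1 with finite Ш, ANY member `W` of the class, ANY rational point `P` of finite index ι:
`L♭₂(E)(ψ₂)·m₂₁(W)·log₂γ·(ι·m₀)² = 8·q·Tam(E₂)·#Ш(E₂)·log_{Ê₂}(m₀P)²`, κ₀ = −4/log₂γ.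
EVIDENCE (BC5 = CensusAN46 §A/§B + CensusAN45): R/q ≡ 1441 (mod 2¹¹) on 954/954 optimal rows (g39, q = 1, N ≤ 7809) and,
g40 (N ≤ 3000 complete, census46.tsv), on 665/665 optimal + 180/180 non-optimal members (122 of them with q ≠ 1:
ρ ∈ {1/3, 3, 1/5, 5, 1/9, 1/13, 1/25}; the unrepaired 43A-shape fails on exactly those 122), 0 violations.  WHY IT MIGHT FAIL: (i) κ₀ known to 11–12 bits
only (REF2 rider (b): a constant ≡ κ₀ mod 2¹² is not excluded); (ii) a class in which TWO members' twists share the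
canonical period but differ in `c²/d` (then at most one can satisfy the law; none seen: ρ = Ω-ratio on 180/180, i.e.
(c/c₂)² = 1); (iii) Ш(E₂) ≠ 1 rows are few (optimal 2611a1, 2837a1, 5753b1 with Ш = 4 hold WITH Ш; non-optimal 651e3,
3213u2, 3605c3, 4123c3, 5859f2 (Ш = 9), 5753b2 (Ш = 4) hold after q — CensusAN46 §B); (iv) normalisation of `IsSprungPair`/`evalAt` at p = 2.  WHY NOVEL: as 43A (no p-adic
Gross–Zagier/Rubin formula at p = 2 at a character outside the interpolation range exists in print: Kobayashi 2013
Invent. 191 Thm 1.1 is p odd; REF2 v70: NOT IN PRINT, VARIANT-TRANSPLANT) plus the period selector, which says the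
dictionary is between `L♭` (normalised by Ω⁺_f) and the twist's BSD data (normalised by Ω(E₂)) and is exact only
where Pal's twist-period relation is the canonical one.  Sources: Kobayashi2013 doi:10.1007/s00222-012-0400-9; Sprung
arXiv:1601.00010; Pal2012 doi:10.1090/S0002-9939-2011-11017-9 Thm 3.2; Katz 1981 (acq-14939); CensusAN45/46. -/
@[conjecture] def FlatBlindGrossZagierAtChi8Q : Prop :=
  ∀ (W : WeierstrassCurve ℚ) [W.IsElliptic] [W.IsGloballyMinimal] [NeZero (W.conductorNorm ℤ)]
    (f : CuspForm (Gamma0 (W.conductorNorm ℤ)) 2), IsNewformOf W f → GoodSS W 2 →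
    W.rootNumber * ZMod.χ₈ (W.conductorNorm ℤ : ZMod 8) = -1 →
    ∀ (Ls Lf : IwasawaAlgebra 2), IsSprungPair f 2 (W.frobeniusTrace 2) Ls Lf →
    ∀ (W₂ : WeierstrassCurve ℚ) [W₂.IsElliptic] [W₂.IsGloballyMinimal],
      (∃ C : WeierstrassCurve.VariableChange ℚ, C • W.quadraticTwist 2 = W₂) →
    ∀ (q : ℚ), (q : ℝ) * (2 * plusPeriod f) = W₂.realPeriodRat * Real.sqrt 8 →
      W₂.analyticRank = 1 → W₂.shaOrder ≠ 0 →
    ∀ (m₁₁ m₂₁ : ℤ_[2]), IsKatzFrobeniusColumn (W.map (Rat.castHom ℚ_[2])) m₁₁ m₂₁ →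
    ∀ (P : (W₂.baseChange ℚ).toAffine.Point) (ι : ℕ),
      (AddSubgroup.zmultiples P).index = ι → ι ≠ 0 →
      ((evalAt (-2 : ℤ_[2]) Lf : ℤ_[2]) : ℚ_[2]) * (m₂₁ : ℚ_[2]) * logCycGenTwo *
          ((ι : ℚ_[2]) * (formalIndex W₂ 2 : ℚ_[2])) ^ 2 =
        8 * (q : ℚ_[2]) * (W₂.tamagawaProduct : ℚ_[2]) * (W₂.shaOrder : ℚ_[2]) *
          ((W₂.baseChange ℚ_[2]).padicLogPoint
              (formalIndex W₂ 2 • padicPointOf W₂ 2 (Rat.castHom ℚ_[2]) P)) ^ 2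

/-- **P-an-44A⁻ `FlatBlindGrossZagierAtChiMinus8Q` (conjecture; -an g40 §44 (C) — the ODD BRANCH).**
The twin of 44A⁺ on Sprung's odd (`ω = χ₋₄`) branch: the blind character of `θ⁻_n` at `T = −2` is
`ξγ^s ↦ ω(ξ)(−1)^s = χ₋₈` (`mazurTateElementOdd`), the twist is `E₋₂ = E^{(−2)}` (conductor 64N, root number
`−w(E)·χ₋₈(N)`, so the rank-one locus is `w(E)·χ₋₈(N) = +1`), the period ratio reads
`q = Ω(W₂)·√8 / (2·Ω⁻_f)` (`minusPeriod f`; q = 1 for the optimal curve: Pal 2012 Thm 3.2 for d < 0 — proved in the tree as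
`realPeriodRat_mul_sqrt_of_twist_of_neg` — with ũ = 2; engine-50 Pal column = 2.000; inside a class q scales by the
IMAGINARY-period ratio `Ω⁻(W′)/Ω⁻(W)`, = 1 throughout 11a, 19a, 651e where the real periods differ by 5^{±1}, 3^{±1}, 9),
and the constant is `−8`: `L♭₋(χ₋₈)·m₂₁·log₂γ·(ι·m₀)² = −8·q·Tam(E₋₂)·#Ш(E₋₂)·log(m₀P)²`, i.e. κ₀⁻ = +4/log₂γ = −κ₀⁺ (tree units:
`[r]⁻ = ratMinusSymbol`, `im Λ_f = ℤ·Ω⁻_f/2`, Birch `(∑χ(a)[a/m]⁻)·Ω⁻·i = τ(χ)·L(f,χ̄,1)`; engine calibration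
`[r]⁻ = −x⁻_PARI(r)/c_∞` on five odd d per curve).  PRE-REGISTERED before the data: unit(R⁻) mod 2¹¹ ∈ {1441, 607},
v₂(R⁻) = 0; OBSERVED (CensusAN46 §C, N ≤ 3000 complete): R⁻/q ≡ 607 on 672/672 optimal rows (q = 1; a₂ ∈ {0, ±2}, c_∞ ∈ {1, 2},
43 Tamagawa values, Ш ∈ {4, 9} rows 3797a1, 5805g1, 7451a1 WITH Ш) and on 201/201 non-optimal members (64 with q ≠ 1:
q = the Ω⁻-lattice ratio of the untwisted member, NOT REF1's Ω⁺-reading, engine 51), 0 violations.  WHY IT MIGHT FAIL: as 44A⁺ (i)–(iv); additionally (v) the relative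
sign −1 between the branches is tied to the orientation conventions of `minusSymbol`/`minusPeriod` (a global sign in
`ratMinusSymbol` would turn −8 into +8) — (v) CLOSED by REF1 §394 (2026-08-30): `minusPeriod f > 0`, `minusSymbol = ({∞,r}−{∞,−r})/2`
and Birch-odd are PROVED in tree (`ratMinusTwistedSymbolSum_mul_minusPeriod_mul_I`, `τ(χ₋₈) = +i√8` with Mathlib's
`stdAddChar`), against which this file's dictionary is calibrated (CensusAN46 §D), so `κ⁻ = −κ⁺` is a genuine prediction; and
(R394a) the binder `IsSprungPairOdd f 2 a₂ Ls Lf` is NON-VACUOUS and SINGLE-VALUED by the tree theorems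
`Sprung2017.exists_isSprungPairOdd_two` / `IsSprungPairOdd.unique` / `existsUnique_isSprungPairOdd_two`
(`MazurTateElementOddPairProofs.lean`, 2026-08-27).  REF1 §394 AUDIT (A1–A6 + BC7 + independent re-tally of all 1718 rows):
44A⁻ SURVIVES as typed, 873/873.  WHY NOVEL: as 44A⁺ — and the odd branch at p = 2 (`IsSprungPairOdd`) has no
special-value statement anywhere in print or tree (corpus fts+vec + galaxy: 0 hits for «χ₋₈»/«odd branch» p-adic
L-function special value at p = 2).  Sources: as 44A⁺; MazurTateTeitelbaum1986 §I.8; tree `MazurTateElementOdd`. -/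
@[conjecture] def FlatBlindGrossZagierAtChiMinus8Q : Prop :=
  ∀ (W : WeierstrassCurve ℚ) [W.IsElliptic] [W.IsGloballyMinimal] [NeZero (W.conductorNorm ℤ)]
    (f : CuspForm (Gamma0 (W.conductorNorm ℤ)) 2), IsNewformOf W f → GoodSS W 2 →
    W.rootNumber * ZMod.χ₈' (W.conductorNorm ℤ : ZMod 8) = 1 →
    ∀ (Ls Lf : IwasawaAlgebra 2), IsSprungPairOdd f 2 (W.frobeniusTrace 2) Ls Lf →
    ∀ (W₂ : WeierstrassCurve ℚ) [W₂.IsElliptic] [W₂.IsGloballyMinimal],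
      (∃ C : WeierstrassCurve.VariableChange ℚ, C • W.quadraticTwist (-2) = W₂) →
    ∀ (q : ℚ), (q : ℝ) * (2 * minusPeriod f) = W₂.realPeriodRat * Real.sqrt 8 →
      W₂.analyticRank = 1 → W₂.shaOrder ≠ 0 →
    ∀ (m₁₁ m₂₁ : ℤ_[2]), IsKatzFrobeniusColumn (W.map (Rat.castHom ℚ_[2])) m₁₁ m₂₁ →
    ∀ (P : (W₂.baseChange ℚ).toAffine.Point) (ι : ℕ),
      (AddSubgroup.zmultiples P).index = ι → ι ≠ 0 →
      ((evalAt (-2 : ℤ_[2]) Lf : ℤ_[2]) : ℚ_[2]) * (m₂₁ : ℚ_[2]) * logCycGenTwo *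
          ((ι : ℚ_[2]) * (formalIndex W₂ 2 : ℚ_[2])) ^ 2 =
        -8 * (q : ℚ_[2]) * (W₂.tamagawaProduct : ℚ_[2]) * (W₂.shaOrder : ℚ_[2]) *
          ((W₂.baseChange ℚ_[2]).padicLogPoint
              (formalIndex W₂ 2 • padicPointOf W₂ 2 (Rat.castHom ℚ_[2]) P)) ^ 2

/-- **P-an-44C⁺ `BlindPAdicGrossZagierRatioPlus` (conjecture; -an g40 §44 — the CLASS-INVARIANT form, «blind 2-adic
Gross–Zagier»).**  For EVERY curve `W` of the class of `f` (no optimality, no period condition), `E₂ = E^{(2)}` of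
analytic rank 1, ANY rational point `P` of `E₂` and any rational `q` with
`q·√8·L′(E₂,1) = Ω⁺_f·ĥ(P)` (the algebraic part of the archimedean Gross–Zagier ratio; it exists and is unique by
Gross–Zagier–Kolyvagin since `L′(E₂,1) ≠ 0`, and `P` torsion forces `q = 0`):
`L♭₂(E)(ψ₂) · m₂₁(W) · log₂γ · m₀² · q = 4 · log_{Ê₂}(m₀P)²`  (`ĥ` = `canonicalHeight`, Clay normalisation, no ½;
`L′(E₂,1) = leadingLCoeff`).  It is 44A⁺ with BSD's `Tam·Ш·Ω(E₂)/ι² = L′/ĥ(P)` substituted (the period ratio q absorbs `Ω(E₂) = 2qΩ⁺_f/√8`) — after which nothing depends on the member: under `φ : W → W′` (`deg d`, `φ*ω′ = cω`,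
twisted `φ₂*ω₂′ = c₂ω₂`) the left side scales by `(c²/d)·d·… = c²` via `m₂₁` and `ĥ(φ₂P) = d·ĥ(P)`, the right side by
`c₂²` via `log`, and `c² = c₂²` (minimal twists at 2 of curves with good reduction at 2; CensusAN46 §A: (c/c₂)² = 1 on
all 381 non-optimal rows, both signs).  No Ш, Tamagawa number, torsion or index appears.  EVIDENCE: CensusAN46 (it is equivalent, given BSD for E₂ —
numerically part of Cremona's table — to R·ρ⁻¹ ≡ 1441 mod 2¹¹, verified on optimal AND non-optimal rows).  WHY IT MIGHT
FAIL: (i) 11–12 bits; (ii) `c² ≠ c₂²` for some isogeny (a 2-power discrepancy between the minimal scalings of φ and of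
its twist); (iii) rows with `P` of index > 1 enter only through `ĥ(ιP₀) = ι²ĥ(P₀)` (a theorem) — no new data there.
WHY NOVEL: the statement is a p-adic Gross–Zagier formula at p = 2 at the blind character ψ₂ in which the p-adic height
is replaced by `4·log_ω(P)²/(⟨ω,φω⟩·log₂γ)`: Kobayashi 2013 Thm 1.1 (p odd, trivial character) has the p-adic height of
the Heegner point and `(1 − 1/α)²`-type constants; here α is eliminated between the two roots and the archimedean side
enters only through its algebraic part `q`.  PLACEMENT (REF2 g70, 2026-08-30, ADOPTED verbatim): «YES in the ANTICYCLOTOMIC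
(Waldspurger/BDP) variable — Kriz–Li 2019 Thm 1.12/1.16, p = 2 split in K —, NO in the CYCLOTOMIC / Mazur–Tate–Sprung variable
that 44A±/44C± live in: NOT IN PRINT as statements; grade VARIANT-TRANSPLANT; 44C± the attackable form»; REF1 §394: SURVIVES as
typed (1718/1718), 44A⁺ = 44C⁺ + BSD(E₂) exactly (R394b).  Sources: as 44A⁺; GrossZagier1986; Kolyvagin1990; KrizLi2019 Thm 1.12. -/
@[conjecture] def BlindPAdicGrossZagierRatioPlus : Prop :=
  ∀ (W : WeierstrassCurve ℚ) [W.IsElliptic] [W.IsGloballyMinimal] [NeZero (W.conductorNorm ℤ)]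
    (f : CuspForm (Gamma0 (W.conductorNorm ℤ)) 2), IsNewformOf W f → GoodSS W 2 →
    W.rootNumber * ZMod.χ₈ (W.conductorNorm ℤ : ZMod 8) = -1 →
    ∀ (Ls Lf : IwasawaAlgebra 2), IsSprungPair f 2 (W.frobeniusTrace 2) Ls Lf →
    ∀ (W₂ : WeierstrassCurve ℚ) [W₂.IsElliptic] [W₂.IsGloballyMinimal],
      (∃ C : WeierstrassCurve.VariableChange ℚ, C • W.quadraticTwist 2 = W₂) →
      W₂.analyticRank = 1 →
    ∀ (m₁₁ m₂₁ : ℤ_[2]), IsKatzFrobeniusColumn (W.map (Rat.castHom ℚ_[2])) m₁₁ m₂₁ →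
    ∀ (P : (W₂.baseChange ℚ).toAffine.Point) (q : ℚ),
      (q : ℝ) * Real.sqrt 8 * (W₂.leadingLCoeff).re = plusPeriod f * P.canonicalHeight →
      ((evalAt (-2 : ℤ_[2]) Lf : ℤ_[2]) : ℚ_[2]) * (m₂₁ : ℚ_[2]) * logCycGenTwo *
          (formalIndex W₂ 2 : ℚ_[2]) ^ 2 * (q : ℚ_[2]) =
        4 * ((W₂.baseChange ℚ_[2]).padicLogPoint
              (formalIndex W₂ 2 • padicPointOf W₂ 2 (Rat.castHom ℚ_[2]) P)) ^ 2

/-- **P-an-44C⁻ `BlindPAdicGrossZagierRatioMinus` (conjecture; -an g40 §44 — odd-branch twin of 44C⁺).**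
Same statement on the `χ₋₈` branch: Sprung's odd pair, twist `E₋₂ = E^{(−2)}`, rank-one locus `w(E)·χ₋₈(N) = +1`,
`q·√8·L′(E₋₂,1) = Ω⁻_f·ĥ(P)`, constant `−4`:
`L♭₋(χ₋₈) · m₂₁(W) · log₂γ · m₀² · q = −4 · log_{Ê₋₂}(m₀P)²`.  EVIDENCE / WHY IT MIGHT FAIL / WHY NOVEL: as 44C⁺ and
44A⁻ (sign (v), closed by REF1 §394; odd-pair binder non-vacuous and unique: `existsUnique_isSprungPairOdd_two`, R394a).
(R394b, REF1 §394 + REF2 g70, ADOPTED:) 44A⁻ = 44C⁻ + BSD(E₋₂) EXACTLY (K394.3: `2·q_A·q_C·Tam·Ш = ι²`), so 44C± are THE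
attackable candidates of this file and 44A± their BSD-corollaries; a prover USING either needs the q-existence facts
(`Ω(W)/Ω^±_f ∈ ℚ`, Pal — tree; Gross–Zagier–Kolyvagin rationality — print only, R394c) as Literature facts.  REF1 §394: 44C⁻
SURVIVES as typed (1718/1718 with 44C⁺; `P = O` admitted and true there, K394.7).  Sources: as 44A⁻. -/
@[conjecture] def BlindPAdicGrossZagierRatioMinus : Prop :=
  ∀ (W : WeierstrassCurve ℚ) [W.IsElliptic] [W.IsGloballyMinimal] [NeZero (W.conductorNorm ℤ)]
    (f : CuspForm (Gamma0 (W.conductorNorm ℤ)) 2), IsNewformOf W f → GoodSS W 2 →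
    W.rootNumber * ZMod.χ₈' (W.conductorNorm ℤ : ZMod 8) = 1 →
    ∀ (Ls Lf : IwasawaAlgebra 2), IsSprungPairOdd f 2 (W.frobeniusTrace 2) Ls Lf →
    ∀ (W₂ : WeierstrassCurve ℚ) [W₂.IsElliptic] [W₂.IsGloballyMinimal],
      (∃ C : WeierstrassCurve.VariableChange ℚ, C • W.quadraticTwist (-2) = W₂) →
      W₂.analyticRank = 1 →
    ∀ (m₁₁ m₂₁ : ℤ_[2]), IsKatzFrobeniusColumn (W.map (Rat.castHom ℚ_[2])) m₁₁ m₂₁ →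
    ∀ (P : (W₂.baseChange ℚ).toAffine.Point) (q : ℚ),
      (q : ℝ) * Real.sqrt 8 * (W₂.leadingLCoeff).re = minusPeriod f * P.canonicalHeight →
      ((evalAt (-2 : ℤ_[2]) Lf : ℤ_[2]) : ℚ_[2]) * (m₂₁ : ℚ_[2]) * logCycGenTwo *
          (formalIndex W₂ 2 : ℚ_[2]) ^ 2 * (q : ℚ_[2]) =
        -4 * ((W₂.baseChange ℚ_[2]).padicLogPoint
              (formalIndex W₂ 2 • padicPointOf W₂ 2 (Rat.castHom ℚ_[2]) P)) ^ 2

/-- support (rank 9; TURNKEY, elementary — REF2 v70-add3 rider (c) «torsion rows as falsifiers» made into a lemma;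
MEMO-an §44.0).  Good supersingular reduction at 2 kills the rational 2-torsion of EVERY quadratic twist, so the
torsion factor in 44A± is odd (observed: `tors = 1` on all 1718 twist members of CensusAN46) and the «torsion-row
falsifier» of the ψ₂-dictionary is vacuous on this population.  Proof sketch (one screen): a point `P = (x, y)` of
`W.quadraticTwist d` (model `y² = x³ + d(b₂/4)x² + d²(b₄/2)x + d³(b₆/4)`, `a₁ = a₃ = 0`) with `2 • P = 0` has `y = 0`,
so `t := x/d` is a rational root of the 2-division cubic `4t³ + b₂t² + 2b₄t + b₆` of `W` (independent of `d`:
`E^{(d)}[2] ≅ E[2]` as Galois modules).  `GoodSS W 2` on a globally minimal model forces `2 ∣ a₁` (supersingular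
⟺ `ā₁ = 0` in characteristic 2) and then `2 ∤ a₃` (smoothness of `y² + ā₃y = …`), hence `4 ∣ b₂`, `2 ∣ b₄`,
`2 ∤ b₆`; for `t ∈ ℤ₂` the cubic is odd, and for `v₂(t) = −m < 0` the term `4t³` has the unique minimal
valuation `2 − 3m` — no root in `ℚ₂`, a fortiori none in `ℚ` (the same count excludes every quadratic `K/ℚ₂`:
ties would need `e = 3m`).  Sources: Silverman AEC VII.3 / VIII.7 (2-division polynomial), tree
`Literature.NumberTheory.EllipticCurves.QuadraticTwist` (the model), `Rank1Residual.Predicates.GoodSS`. -/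
def NoRationalTwoTorsionOfGoodSSAtTwo : Prop :=
  ∀ (W : WeierstrassCurve ℚ) [W.IsElliptic] [W.IsGloballyMinimal], GoodSS W 2 →
    ∀ (d : ℚ), d ≠ 0 → ∀ (P : (W.quadraticTwist d).toAffine.Point), (2 : ℕ) • P = 0 → P = 0

end Summit.BirchSwinnertonDyer.Cruxes.RankOneAtTwoBigImageOddLocal.BlindGZAN58

end
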